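/-
Copyright: the b2b-balaban T⁴-continuum CRUX team, row NE7b OWNER lineage `t4-ne7b-p1` (gen 119). Project licence.
-/
import Mathlib.Topology.UniformSpace.HeineCantor
import Summits.QuantumFields.BalabanUV.T4Continuum.Spine.NE7b.SupConvexStepSemigroup

/-!
# THE ENVELOPES OF THE CONVEX CLASS: a differentiable action with (110)'s first-order letter has a CONTINUOUS gradient (the class is
# a `C¹` class for free), `e^{−S}` lies under ONE Gaussian about any base point (`m > 0`), and on the TWO-SIDED class (`+` the upper
# letter `S ψ ≤ S φ + S′φ(ψ − φ) + ½Λ·Σ(ψ − φ)²`) the gradient norm grows at most quadratically and `e^{−S}‖S′‖` lies under one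
# Gaussian — the three envelopes the fluctuation integral of the sequel `…SupConvexFibreIntegral` consumes
# (row NE7b, node U5c; (110)'s class conventions + (93) BY NAME; [folklore])

Cell `pub-balaban`, sub-cell `t4`, spine estimate NE7b (`T4WeightBudget.RelWeightBound`; the cell's OWN estimate — NOT PRINTED in
[Bałaban 1983–89], NOT PROVED).  Crux-route work under `Spine/NE7b/` by the row OWNER (`t4-ne7b-p1` gen 119) under FREEZE (0)'s
crux-prover clause, on the OWNER g118's located NEXT item (3)(c) «the measure side of the abstract class»; NOTHING of Bałaban's is
named as a Lean object, valued or asserted; no `T4Continuum/Support` leaf typed; no `def`, no notation; zero `sorry`.  Imports (BY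
NAME): the OWNER's (110) `…SupConvexStepSemigroup` (the class conventions `hS : HasFDerivAt S (S′φ) φ`,
`S φ + S′φ(ψ − φ) + ½m·Σ(ψ − φ)² ≤ S ψ`; through it (93) `norm_sq_le_sum_sq`), Mathlib's Heine–Cantor.

WHY (located).  (110)–(113) iterate the MINIMISING block-spin step on the class; the true renormalisation step INTEGRATES the fibre,
`W_int(w) = −log ∫ e^{−S(M w + P z)} dz`, and putting `W_int` back in the class needs the integrand and its base derivative
`e^{−S}·(S′∘M)` measurable and dominated uniformly over nearby base points.  Measurability is continuity of `S′` — which the class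
already has: a differentiable convex function on a finite carrier is `C¹` (`ε∕3`: differentiability at the point, uniform continuity
of `S` on a compact ball, the convexity letter at the nearby point, both signs).  Domination is a Gaussian envelope: the lower letter
bounds `e^{−S}` by `e^{−(m∕4)Σ(ψ − φ₀)²}` up to a constant, but bounds `‖S′ψ‖` only near `φ₀`; the UPPER letter makes `‖S′ψ‖` grow
at most quadratically (`S′ψ e ≤ S′φ₀ e + ½Λ·Σ(ψ + e − φ₀)²`), and then `e^{−S}‖S′‖` lies under `e^{−(m∕8)Σ(ψ − φ₀)²}` — so the
honest iterable class for the INTEGRATED step is the two-sided one (quadratic actions; potentials with `−λ ≤ u′ ≤ Λ_u`).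

WHAT IS PROVED ([folklore]; finite carrier `ι`, sup norm, `Σ`-of-squares currency as in (110)):
* §1 (the convexity letter `S φ + S′φ(ψ − φ) ≤ S ψ`, i.e. the class with any `m ≥ 0`) `continuous_of_hasFDerivAt`,
  **`continuous_gradient`** (`HasFDerivAt S (S′φ) φ` everywhere + the convexity letter ⟹ `Continuous S′`).
* §2 (modulus `m`) `lower_envelope` (`S φ₀ − ‖S′φ₀‖‖ψ − φ₀‖ + ½m·Σ(ψ − φ₀)² ≤ S ψ`), **`exp_neg_le_gaussian`** (`m > 0`:
  `e^{−S ψ} ≤ e^{−S φ₀ + ‖S′φ₀‖²∕m}·e^{−(m∕4)Σ(ψ − φ₀)²}`).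
* §3 (the two-sided class, `Λ ≥ 0`) `sum_sq_le_card_mul_norm_sq`, `gradient_apply_le`, **`opNorm_gradient_le`**
  (`‖S′ψ‖ ≤ ‖S′φ₀‖ + Λ(Σ(ψ − φ₀)² + |ι|)`), `mul_exp_neg_le`, **`weighted_envelope`**
  (`e^{−S ψ}‖S′ψ‖ ≤ e^{−S φ₀ + ‖S′φ₀‖²∕m}(‖S′φ₀‖ + Λ|ι| + 8Λ∕m)·e^{−(m∕8)Σ(ψ − φ₀)²}`).
* §4 toy.

HONEST (what this is NOT).  Finite-dimensional calculus; no measure, no step (the sequel); the two-sided class is an honest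
restriction (a `φ⁴` potential has no global upper modulus — its domination needs a polynomial-growth variant, not typed); constants
are the displayed envelopes only; nothing of Bałaban's ((A3), NC-NE7b-α UNRULED).  BY-NAME EFFECT ON THE WALL: NONE.  NE7b NOT
PRINTED ∕ NOT PROVED; spine PROVED 0∕9; rung (B)+1 on a FINITE torus — NOT infinite volume, NOT the mass gap, NOT Clay.  HONEST
DEPENDENCY: continuum YM on T⁴ ⇐ BetaPertH ∧ nine spine estimates (0∕9 proved); BetaPertH ⇐ (D1) ∧ (D4) ∧ CAP+tail; G-an2-4 gates
asym, D1 and NE2∕3∕4.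
-/

set_option autoImplicit false

noncomputable section

namespace Summit.QuantumFields.BalabanUV.T4Continuum.NE7b.SupConvexClassEnvelope

open Set Function Filter Metric Real
open scoped Topology
open SupTorusActionMinimiser (norm_sq_le_sum_sq)

/-! ## §1. A differentiable convex function on a finite carrier has a continuous gradient -/

section Gradient

variable {ι : Type*} [Fintype ι] {S : (ι → ℝ) → ℝ} {S' : (ι → ℝ) → (ι → ℝ) →L[ℝ] ℝ}

omit [Fintype ι] in
/-- A function differentiable everywhere (on any real normed space) is continuous. [folklore] -/
theorem continuous_of_hasFDerivAt {E : Type*} [NormedAddCommGroup E] [NormedSpace ℝ E] {f : E → ℝ} {f' : E → E →L[ℝ] ℝ}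
    (hf : ∀ x, HasFDerivAt f (f' x) x) : Continuous f :=
  continuous_iff_continuousAt.2 fun x => (hf x).continuousAt

/-- **THE GRADIENT OF A DIFFERENTIABLE CONVEX FUNCTION IS CONTINUOUS** (finite carrier): `HasFDerivAt S (S′φ) φ` everywhere and
the convexity letter `S φ + S′φ(ψ − φ) ≤ S ψ` ⟹ `φ ↦ S′φ` is continuous (so `S` is `C¹`).  Proof: for a unit `e` and small `t₀`,
`S′ψ(t₀e) ≤ S(ψ + t₀e) − S ψ ≈ S(φ + t₀e) − S φ ≈ S′φ(t₀e)` by uniform continuity of `S` on a compact ball and differentiability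
at `φ`; the same with `−e`. [folklore] -/
theorem continuous_gradient (hS : ∀ φ, HasFDerivAt S (S' φ) φ) (hconv : ∀ φ ψ : ι → ℝ, S φ + S' φ (ψ - φ) ≤ S ψ) :
    Continuous S' := by
  have hcont : Continuous S := continuous_of_hasFDerivAt hS
  refine Metric.continuous_iff.2 fun φ ε hε => ?_
  -- differentiability at `φ`: `|S(φ + h) − S φ − S′φ h| ≤ (ε/4)‖h‖` for `‖h‖ < t`
  have hε4 : 0 < ε / 4 := by positivity
  have hlo := (hS φ).isLittleO
  rw [Asymptotics.isLittleO_iff] at hlo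
  have hev := hlo hε4
  rw [Filter.Eventually, Metric.mem_nhds_iff] at hev
  obtain ⟨t, ht, hball⟩ := hev
  have hder : ∀ h : ι → ℝ, ‖h‖ < t → |S (φ + h) - S φ - S' φ h| ≤ ε / 4 * ‖h‖ := by
    intro h hh
    have hmem : φ + h ∈ ball φ t := by rw [mem_ball, dist_eq_norm, add_sub_cancel_left]; exact hh
    have := hball hmem
    simp only [mem_setOf_eq, add_sub_cancel_left, Real.norm_eq_abs] at this
    exact this
  set t₀ : ℝ := t / 2 with ht₀_def
  have ht₀ : 0 < t₀ := by positivity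
  have ht₀t : t₀ < t := by rw [ht₀_def]; linarith
  -- uniform continuity of `S` on the compact ball of radius `t₀ + 1`
  have hK : IsCompact (closedBall φ (t₀ + 1)) := isCompact_closedBall φ (t₀ + 1)
  have huc := hK.uniformContinuousOn_of_continuous hcont.continuousOn
  rw [Metric.uniformContinuousOn_iff] at huc
  obtain ⟨δ, hδ, hδuc⟩ := huc (ε / 4 * t₀) (by positivity)
  refine ⟨min δ 1, lt_min hδ one_pos, fun ψ hψ => ?_⟩
  have hψδ : dist ψ φ < δ := lt_of_lt_of_le hψ (min_le_left _ _)
  have hψ1 : dist ψ φ < 1 := lt_of_lt_of_le hψ (min_le_right _ _)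
  -- the one-sided estimate for every unit vector `e`
  have hone : ∀ e : ι → ℝ, ‖e‖ = 1 → S' ψ e - S' φ e ≤ 3 * (ε / 4) := by
    intro e he
    have hte : ‖t₀ • e‖ = t₀ := by rw [norm_smul, he, mul_one, Real.norm_eq_abs, abs_of_pos ht₀]
    -- the four points lie in the compact ball
    have hφK : φ ∈ closedBall φ (t₀ + 1) := mem_closedBall_self (by positivity)
    have hψK : ψ ∈ closedBall φ (t₀ + 1) := by
      rw [mem_closedBall]; linarith [hψ1.le]
    have hφeK : φ + t₀ • e ∈ closedBall φ (t₀ + 1) := by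
      rw [mem_closedBall, dist_eq_norm, add_sub_cancel_left, hte]; linarith
    have hψeK : ψ + t₀ • e ∈ closedBall φ (t₀ + 1) := by
      rw [mem_closedBall, dist_eq_norm, show ψ + t₀ • e - φ = (ψ - φ) + t₀ • e by abel]
      have := norm_add_le (ψ - φ) (t₀ • e)
      rw [hte, ← dist_eq_norm] at this
      linarith [hψ1.le]
    -- convexity at `ψ` towards `ψ + t₀e`
    have h1 : S' ψ (t₀ • e) ≤ S (ψ + t₀ • e) - S ψ := by
      have := hconv ψ (ψ + t₀ • e)
      rw [add_sub_cancel_left] at this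
      linarith
    -- uniform continuity twice
    have h2 : dist (S (ψ + t₀ • e)) (S (φ + t₀ • e)) < ε / 4 * t₀ :=
      hδuc _ hψeK _ hφeK (by rw [dist_eq_norm, show ψ + t₀ • e - (φ + t₀ • e) = ψ - φ by abel, ← dist_eq_norm]; exact hψδ)
    have h3 : dist (S ψ) (S φ) < ε / 4 * t₀ := hδuc _ hψK _ hφK hψδ
    rw [Real.dist_eq] at h2 h3
    -- differentiability at `φ` along `t₀e`
    have h4 := hder (t₀ • e) (by rw [hte]; exact ht₀t)
    rw [hte] at h4
    have h5 : S' ψ (t₀ • e) - S' φ (t₀ • e) ≤ 3 * (ε / 4) * t₀ := by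
      have := abs_lt.1 h2
      have := abs_lt.1 h3
      have := abs_le.1 h4
      linarith
    rw [map_smul, map_smul, smul_eq_mul, smul_eq_mul, ← mul_sub] at h5
    have h6 : t₀ * (S' ψ e - S' φ e) ≤ t₀ * (3 * (ε / 4)) := h5.trans_eq (by ring)
    exact le_of_mul_le_mul_left h6 ht₀
  -- both signs, then the operator norm
  rw [dist_eq_norm]
  have hop : ‖S' ψ - S' φ‖ ≤ 3 * (ε / 4) := by
    refine ContinuousLinearMap.opNorm_le_of_unit_norm (by positivity) fun e he => ?_
    rw [sub_apply, Real.norm_eq_abs, abs_le]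
    refine ⟨?_, hone e he⟩
    have hneg := hone (-e) (by rw [norm_neg, he])
    rw [map_neg, map_neg] at hneg
    linarith
  linarith

end Gradient

/-! ## §2. The Gaussian envelope of the first-order letter -/

section Envelope

variable {ι : Type*} [Fintype ι] {S : (ι → ℝ) → ℝ} {S' : (ι → ℝ) → (ι → ℝ) →L[ℝ] ℝ} {m : ℝ}

/-- **THE LOWER ENVELOPE**: the letter at `φ₀` and `|S′φ₀(ψ − φ₀)| ≤ ‖S′φ₀‖·‖ψ − φ₀‖` give
`S φ₀ − ‖S′φ₀‖·‖ψ − φ₀‖ + ½m·Σ(ψ − φ₀)² ≤ S ψ`. [folklore] -/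
theorem lower_envelope (hlo : ∀ φ ψ : ι → ℝ, S φ + S' φ (ψ - φ) + m / 2 * ∑ x, (ψ x - φ x) ^ 2 ≤ S ψ) (φ₀ ψ : ι → ℝ) :
    S φ₀ - ‖S' φ₀‖ * ‖ψ - φ₀‖ + m / 2 * ∑ x, (ψ x - φ₀ x) ^ 2 ≤ S ψ := by
  have h := hlo φ₀ ψ
  have hb : -(‖S' φ₀‖ * ‖ψ - φ₀‖) ≤ S' φ₀ (ψ - φ₀) := by
    have := (S' φ₀).le_opNorm (ψ - φ₀)
    rw [Real.norm_eq_abs] at this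
    exact (abs_le.1 this).1
  linarith

/-- **THE GAUSSIAN ENVELOPE OF `e^{−S}`** (`m > 0`): for every base point `φ₀` and every `ψ`,
`e^{−S ψ} ≤ e^{−S φ₀ + ‖S′φ₀‖²∕m} · e^{−(m∕4)·Σ(ψ − φ₀)²}`. [folklore] -/
theorem exp_neg_le_gaussian (hlo : ∀ φ ψ : ι → ℝ, S φ + S' φ (ψ - φ) + m / 2 * ∑ x, (ψ x - φ x) ^ 2 ≤ S ψ) (hm : 0 < m)
    (φ₀ ψ : ι → ℝ) :
    exp (-S ψ) ≤ exp (-S φ₀ + ‖S' φ₀‖ ^ 2 / m) * exp (-(m / 4) * ∑ x, (ψ x - φ₀ x) ^ 2) := by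
  rw [← exp_add]
  refine exp_le_exp.2 ?_
  have h := lower_envelope hlo φ₀ ψ
  set b : ℝ := ‖S' φ₀‖
  set R2 : ℝ := ∑ x, (ψ x - φ₀ x) ^ 2
  have hn : ‖ψ - φ₀‖ ^ 2 ≤ R2 := by
    have := norm_sq_le_sum_sq (ψ - φ₀)
    simpa only [Pi.sub_apply] using this
  -- `b‖ψ − φ₀‖ ≤ b²/m + (m/4)‖ψ − φ₀‖² ≤ b²/m + (m/4)R2`
  have hamgm : b * ‖ψ - φ₀‖ ≤ b ^ 2 / m + m / 4 * ‖ψ - φ₀‖ ^ 2 := by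
    rw [← sub_nonneg]
    have e : b ^ 2 / m + m / 4 * ‖ψ - φ₀‖ ^ 2 - b * ‖ψ - φ₀‖ = (b - m / 2 * ‖ψ - φ₀‖) ^ 2 / m := by
      field_simp; ring
    rw [e]; exact div_nonneg (sq_nonneg _) hm.le
  have hb4 : m / 4 * ‖ψ - φ₀‖ ^ 2 ≤ m / 4 * R2 := mul_le_mul_of_nonneg_left hn (by positivity)
  linarith

end Envelope

/-! ## §3. The two-sided class: quadratic growth of the gradient, the weighted envelope -/

section TwoSided

variable {ι : Type*} [Fintype ι] {S : (ι → ℝ) → ℝ} {S' : (ι → ℝ) → (ι → ℝ) →L[ℝ] ℝ} {m Λ : ℝ}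

/-- On a finite carrier with the sup norm, `Σ_x (e x)² ≤ |ι|·‖e‖²`. [folklore] -/
theorem sum_sq_le_card_mul_norm_sq (e : ι → ℝ) : ∑ x, e x ^ 2 ≤ Fintype.card ι * ‖e‖ ^ 2 := by
  have h : ∀ x, e x ^ 2 ≤ ‖e‖ ^ 2 := fun x => by
    have := norm_le_pi_norm e x
    rw [Real.norm_eq_abs] at this
    calc e x ^ 2 = |e x| ^ 2 := (sq_abs _).symm
      _ ≤ ‖e‖ ^ 2 := pow_le_pow_left₀ (abs_nonneg _) this 2
  calc ∑ x, e x ^ 2 ≤ ∑ _x : ι, ‖e‖ ^ 2 := Finset.sum_le_sum fun x _ => h x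
    _ = Fintype.card ι * ‖e‖ ^ 2 := by rw [Finset.sum_const, Finset.card_univ, nsmul_eq_mul]

/-- **ONE-SIDED GROWTH OF THE GRADIENT ON THE TWO-SIDED CLASS**: the convexity letter (at `ψ` and at `φ₀`) and the upper letter
at `φ₀` give `S′ψ e ≤ S′φ₀ e + ½Λ·Σ(ψ + e − φ₀)²` for every direction `e`. [folklore] -/
theorem gradient_apply_le (hconv : ∀ φ ψ : ι → ℝ, S φ + S' φ (ψ - φ) ≤ S ψ)
    (hup : ∀ φ ψ : ι → ℝ, S ψ ≤ S φ + S' φ (ψ - φ) + Λ / 2 * ∑ x, (ψ x - φ x) ^ 2) (φ₀ ψ e : ι → ℝ) :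
    S' ψ e ≤ S' φ₀ e + Λ / 2 * ∑ x, (ψ x + e x - φ₀ x) ^ 2 := by
  have h1 := hconv ψ (ψ + e)
  have h2 := hup φ₀ (ψ + e)
  have h3 := hconv φ₀ ψ
  rw [add_sub_cancel_left] at h1
  have hlin : S' φ₀ (ψ + e - φ₀) = S' φ₀ (ψ - φ₀) + S' φ₀ e := by
    rw [show ψ + e - φ₀ = (ψ - φ₀) + e by abel, map_add]
  rw [hlin] at h2
  simp only [Pi.add_apply] at h2 ⊢
  linarith

/-- **QUADRATIC GROWTH OF THE GRADIENT NORM** (`Λ ≥ 0`): `‖S′ψ‖ ≤ ‖S′φ₀‖ + Λ·(Σ(ψ − φ₀)² + |ι|)`. [folklore] -/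
theorem opNorm_gradient_le (hconv : ∀ φ ψ : ι → ℝ, S φ + S' φ (ψ - φ) ≤ S ψ)
    (hup : ∀ φ ψ : ι → ℝ, S ψ ≤ S φ + S' φ (ψ - φ) + Λ / 2 * ∑ x, (ψ x - φ x) ^ 2) (hΛ : 0 ≤ Λ) (φ₀ ψ : ι → ℝ) :
    ‖S' ψ‖ ≤ ‖S' φ₀‖ + Λ * (∑ x, (ψ x - φ₀ x) ^ 2 + Fintype.card ι) := by
  have hR : 0 ≤ ∑ x, (ψ x - φ₀ x) ^ 2 := Finset.sum_nonneg fun x _ => sq_nonneg _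
  refine ContinuousLinearMap.opNorm_le_of_unit_norm (by positivity) fun e he => ?_
  -- `Σ(ψ ± e − φ₀)² ≤ 2Σ(ψ − φ₀)² + 2|ι|`
  have hsq : ∀ e' : ι → ℝ, ‖e'‖ = 1 → ∑ x, (ψ x + e' x - φ₀ x) ^ 2 ≤ 2 * ∑ x, (ψ x - φ₀ x) ^ 2 + 2 * Fintype.card ι := by
    intro e' he'
    have hpt : ∀ x, (ψ x + e' x - φ₀ x) ^ 2 ≤ 2 * (ψ x - φ₀ x) ^ 2 + 2 * e' x ^ 2 := fun x => by
      nlinarith [sq_nonneg (ψ x - φ₀ x - e' x)]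
    have hs := sum_sq_le_card_mul_norm_sq e'
    rw [he', one_pow, mul_one] at hs
    calc ∑ x, (ψ x + e' x - φ₀ x) ^ 2 ≤ ∑ x, (2 * (ψ x - φ₀ x) ^ 2 + 2 * e' x ^ 2) := Finset.sum_le_sum fun x _ => hpt x
      _ = 2 * ∑ x, (ψ x - φ₀ x) ^ 2 + 2 * ∑ x, e' x ^ 2 := by rw [Finset.sum_add_distrib, Finset.mul_sum, Finset.mul_sum]
      _ ≤ 2 * ∑ x, (ψ x - φ₀ x) ^ 2 + 2 * Fintype.card ι := by linarith
  have hb0 : ∀ e' : ι → ℝ, ‖e'‖ = 1 → |S' φ₀ e'| ≤ ‖S' φ₀‖ := fun e' he' => by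
    have := (S' φ₀).le_opNorm e'
    rw [he', mul_one, Real.norm_eq_abs] at this
    exact this
  have hplus := gradient_apply_le hconv hup φ₀ ψ e
  have hminus := gradient_apply_le hconv hup φ₀ ψ (-e)
  rw [map_neg, map_neg] at hminus
  simp only [Pi.neg_apply, ← sub_eq_add_neg] at hminus
  have hsqp := hsq e he
  have hsqm : ∑ x, (ψ x - e x - φ₀ x) ^ 2 ≤ 2 * ∑ x, (ψ x - φ₀ x) ^ 2 + 2 * Fintype.card ι := by
    have := hsq (-e) (by rw [norm_neg, he])
    simpa only [Pi.neg_apply, ← sub_eq_add_neg] using this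
  have hbe := abs_le.1 (hb0 e he)
  rw [Real.norm_eq_abs, abs_le]
  constructor
  · nlinarith [mul_le_mul_of_nonneg_left hsqm (by positivity : 0 ≤ Λ / 2)]
  · nlinarith [mul_le_mul_of_nonneg_left hsqp (by positivity : 0 ≤ Λ / 2)]

/-- `x·e^{−x} ≤ 1`, in the form `R·e^{−aR} ≤ 1∕a` for `a > 0`, `R ≥ 0`. [folklore] -/
theorem mul_exp_neg_le {a R : ℝ} (ha : 0 < a) : R * exp (-(a * R)) ≤ 1 / a := by
  have h1 : a * R ≤ exp (a * R) := by linarith [add_one_le_exp (a * R)]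
  rw [exp_neg, ← div_eq_mul_inv, div_le_div_iff₀ (exp_pos _) ha, one_mul]
  linarith

/-- **THE WEIGHTED ENVELOPE** (`m > 0`, `Λ ≥ 0`): `e^{−S ψ}·‖S′ψ‖ ≤ K(φ₀)·e^{−(m∕8)Σ(ψ − φ₀)²}` with
`K(φ₀) = e^{−S φ₀ + ‖S′φ₀‖²∕m}·(‖S′φ₀‖ + Λ|ι| + 8Λ∕m)`. [folklore] -/
theorem weighted_envelope (hlo : ∀ φ ψ : ι → ℝ, S φ + S' φ (ψ - φ) + m / 2 * ∑ x, (ψ x - φ x) ^ 2 ≤ S ψ) (hm : 0 < m)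
    (hup : ∀ φ ψ : ι → ℝ, S ψ ≤ S φ + S' φ (ψ - φ) + Λ / 2 * ∑ x, (ψ x - φ x) ^ 2) (hΛ : 0 ≤ Λ) (φ₀ ψ : ι → ℝ) :
    exp (-S ψ) * ‖S' ψ‖ ≤
      exp (-S φ₀ + ‖S' φ₀‖ ^ 2 / m) * (‖S' φ₀‖ + Λ * Fintype.card ι + 8 * Λ / m) *
        exp (-(m / 8) * ∑ x, (ψ x - φ₀ x) ^ 2) := by
  have hconv : ∀ φ ψ : ι → ℝ, S φ + S' φ (ψ - φ) ≤ S ψ := fun φ ψ => by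
    have := hlo φ ψ
    have : 0 ≤ m / 2 * ∑ x, (ψ x - φ x) ^ 2 := mul_nonneg (by positivity) (Finset.sum_nonneg fun x _ => sq_nonneg _)
    linarith
  set R2 : ℝ := ∑ x, (ψ x - φ₀ x) ^ 2 with hR2
  have hR : 0 ≤ R2 := Finset.sum_nonneg fun x _ => sq_nonneg _
  set K0 : ℝ := exp (-S φ₀ + ‖S' φ₀‖ ^ 2 / m)
  set b : ℝ := ‖S' φ₀‖
  have hexp := exp_neg_le_gaussian hlo hm φ₀ ψ
  have hgrad := opNorm_gradient_le hconv hup hΛ φ₀ ψ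
  -- split `e^{−(m/4)R2} = e^{−(m/8)R2}·e^{−(m/8)R2}` and absorb `ΛR2` into one factor
  have hsplit : exp (-(m / 4) * R2) = exp (-(m / 8) * R2) * exp (-(m / 8 * R2)) := by
    rw [← exp_add]; congr 1; ring
  have hE1 : exp (-(m / 8 * R2)) ≤ 1 := by
    rw [exp_le_one_iff]; nlinarith
  have hE2 : R2 * exp (-(m / 8 * R2)) ≤ 8 / m := by
    have := mul_exp_neg_le (a := m / 8) (R := R2) (by positivity)
    rw [one_div, inv_div] at this
    exact this
  have hpos1 : 0 ≤ exp (-(m / 8) * R2) := (exp_pos _).le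
  have hK0 : 0 ≤ K0 := (exp_pos _).le
  calc exp (-S ψ) * ‖S' ψ‖
      ≤ (K0 * exp (-(m / 4) * R2)) * (b + Λ * (R2 + Fintype.card ι)) :=
        mul_le_mul hexp hgrad (norm_nonneg _) (mul_nonneg hK0 (exp_pos _).le)
    _ = K0 * exp (-(m / 8) * R2) * ((b + Λ * Fintype.card ι) * exp (-(m / 8 * R2)) + Λ * (R2 * exp (-(m / 8 * R2)))) := by
        rw [hsplit]; ring
    _ ≤ K0 * exp (-(m / 8) * R2) * ((b + Λ * Fintype.card ι) * 1 + Λ * (8 / m)) := by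
        refine mul_le_mul_of_nonneg_left ?_ (mul_nonneg hK0 hpos1)
        refine add_le_add (mul_le_mul_of_nonneg_left hE1 (by positivity)) (mul_le_mul_of_nonneg_left hE2 hΛ)
    _ = K0 * (b + Λ * Fintype.card ι + 8 * Λ / m) * exp (-(m / 8) * R2) := by ring

end TwoSided

/-! ## §4. Toy -/

/-- Toy (§2 with `S φ = Σ φ²` on one site, base point `0`, modulus `2`): the Gaussian envelope at the origin reads
`e^{−Σψ²} ≤ e^{0}·e^{−½Σψ²}`. -/
example (ψ : Unit → ℝ) :
    exp (-(∑ x, ψ x ^ 2)) ≤ exp (-(∑ x, (0 : Unit → ℝ) x ^ 2) + ‖(0 : (Unit → ℝ) →L[ℝ] ℝ)‖ ^ 2 / 2) *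
      exp (-(2 / 4 : ℝ) * ∑ x, (ψ x - (0 : Unit → ℝ) x) ^ 2) := by
  simp only [Finset.univ_unique, PUnit.default_eq_unit, Finset.sum_singleton, Pi.zero_apply, sub_zero, norm_zero,
    ne_eq, OfNat.ofNat_ne_zero, not_false_eq_true, zero_pow, zero_div, add_zero, neg_zero, exp_zero, one_mul]
  exact exp_le_exp.2 (by nlinarith [sq_nonneg (ψ ())])

end Summit.QuantumFields.BalabanUV.T4Continuum.NE7b.SupConvexClassEnvelope

end
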